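import Summits.ValiantsHypothesis.ValiantsHypothesis.Theorems.KPlusLogSqLawTropicalBSeparatedTower

/-!
# Route «KPlusLogSqLaw», crux `TropicalB` (stmt-ValiantsHypothesis-19771) — THE LEXICOGRAPHIC TOWER, ABSTRACT FORM: the level step
# and the chain bound `n ≤ K·m·5^K` from a LEVEL-MINIMALITY BRIDGE taken as a hypothesis

HONEST FRAMING.  Helper toward the registered stubs `stub_tropThin` / `stub_tropFat` of `Cruxes/TropicalB/Lines/birth.lean`
(crux `Summit.ValiantsHypothesis.ValiantsHypothesis.Theses.KPlusLogSqLaw.TropicalB`, item stmt-ValiantsHypothesis-19771, route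
KPlusLogSqLaw; cell `pub-symmetroid`, seat val-sym-trop-p1 g8, 2026-08-27; `--supports … --as helper`).  A SECTOR theorem; nothing here
bounds `TropicalB` for general designs or bears on `WeakLifting`, DoorA26 / DoorA34, `MatrixDescartes` or VP ≠ VNP.

THE POINT (seat memo SEPARATED-LEVELS-g8.md §3/§5).  `level_step` (…SeparatedLevelStep) and `chain_le_tower` (…SeparatedTower) use the
design hypotheses (pure lexicographic valuations, super-separation, dense bottom class, window) ONLY through the bridge
`SeparatedLex.level_min_of_isDominant`: «the class-`l` cells of a term dominant at a window slope minimise the level objective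
`Σ u − θ·|·|` over matchings of present class-`l` cells avoiding the higher classes' rows and columns».  This file re-proves both with
that bridge as a HYPOTHESIS `hlev` over an arbitrary window predicate `W` (`level_step_of_levelMin`, `chain_le_tower_of_levelMin`), so
that every design class with such a bridge inherits the linear chain bound `n ≤ K·m·5^K` — in particular the ROBUST designs of
`SeparatedLex.level_min_of_isDominant_robust` (…SeparatedLexRobust: valuations within `B` of the lattice), see …SeparatedTowerRobust.
The proofs are those of the two cited theorems, verbatim up to the bridge call.
-/

set_option linter.dupNamespace false
set_option autoImplicit false

namespace Summit.ValiantsHypothesis.ValiantsHypothesis.Theorems.KPlusLogSqLaw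

namespace SeparatedLex

open Summit.ValiantsHypothesis.ValiantsHypothesis.Theorems.MatrixDescartes.Negative
open Finset
open scoped BigOperators
open Literature.Computability.MetaComplexity.PBij
open MatchingExchange

variable {m K : ℕ}

/-- **THE LEVEL STEP FROM A BRIDGE.**  As `level_step` (…SeparatedLevelStep), with the design hypotheses replaced by the level-minimality
bridge `hlev` at the slopes of a window predicate `W`: ODD digits and generic digits in the class `l`, two terms dominant at slopes
`θ₀ < θ₁` of the window with `θ₁` even; conclusions: the three inequalities relating the class-`l` cells and the free sets below them. -/
theorem level_step_of_levelMin (d : Fin K → ℕ) (v ε : Fin m → Fin m → Fin K → ℤ) (u : Fin m → Fin m → Fin K → ℤ)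
    (l : Fin K) (hmono : StrictMono d) (W : ℤ → Prop)
    (hlev : ∀ {θ : ℤ}, W θ → ∀ {p : Equiv.Perm (Fin m) × (Fin m → Fin K)}, IsDominant d v ε θ p →
      ∀ X : Finset (Fin m × Fin m), IsPMatching X → (∀ e ∈ X, ε e.1 e.2 l ≠ 0) →
        (∀ e ∈ X, ∀ b, d l < d (p.2 b) → p.1 b ≠ e.1) → (∀ e ∈ X, ¬ d l < d (p.2 e.2)) →
        ∑ e ∈ ((Finset.univ.filter fun b : Fin m => p.2 b = l).image fun b => (p.1 b, b)), u e.1 e.2 l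
            - θ * ((((Finset.univ.filter fun b : Fin m => p.2 b = l).image fun b => (p.1 b, b))).card : ℤ)
          ≤ ∑ e ∈ X, u e.1 e.2 l - θ * (X.card : ℤ))
    (hodd : ∀ a b, ε a b l ≠ 0 → Odd (u a b l))
    (hgen : ∀ X Y : Finset (Fin m × Fin m), IsPMatching X → IsPMatching Y → (∀ e ∈ X, ε e.1 e.2 l ≠ 0) →
      (∀ e ∈ Y, ε e.1 e.2 l ≠ 0) → X.card = Y.card → ∑ e ∈ X, u e.1 e.2 l = ∑ e ∈ Y, u e.1 e.2 l → X = Y)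
    {θ₀ θ₁ : ℤ} (hθ : θ₀ < θ₁) (he₁ : Even θ₁)
    (hw₀ : W θ₀) (hw₁ : W θ₁)
    {p₀ p₁ : Equiv.Perm (Fin m) × (Fin m → Fin K)} (hp₀ : IsDominant d v ε θ₀ p₀) (hp₁ : IsDominant d v ε θ₁ p₁) :
    let Ua₀ : Finset (Fin m) := Finset.univ \ (Finset.univ.filter fun b => l < p₀.2 b).image p₀.1
    let Ub₀ : Finset (Fin m) := Finset.univ \ (Finset.univ.filter fun b => l < p₀.2 b)
    let Ua₁ : Finset (Fin m) := Finset.univ \ (Finset.univ.filter fun b => l < p₁.2 b).image p₁.1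
    let Ub₁ : Finset (Fin m) := Finset.univ \ (Finset.univ.filter fun b => l < p₁.2 b)
    let S₀ : Finset (Fin m × Fin m) := (Finset.univ.filter fun b : Fin m => p₀.2 b = l).image fun b => (p₀.1 b, b)
    let S₁ : Finset (Fin m × Fin m) := (Finset.univ.filter fun b : Fin m => p₁.2 b = l).image fun b => (p₁.1 b, b)
    let s : ℕ := (Ua₀ \ Ua₁).card + (Ua₁ \ Ua₀).card + (Ub₀ \ Ub₁).card + (Ub₁ \ Ub₀).card
    S₀.card ≤ S₁.card + (Ua₀ \ Ua₁).card + (Ub₀ \ Ub₁).card ∧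
    ((Ua₀ \ dom S₀) \ (Ua₁ \ dom S₁)).card + ((Ua₁ \ dom S₁) \ (Ua₀ \ dom S₀)).card +
      ((Ub₀ \ rng S₀) \ (Ub₁ \ rng S₁)).card + ((Ub₁ \ rng S₁) \ (Ub₀ \ rng S₀)).card + 2 * S₀.card ≤ 5 * s + 2 * S₁.card ∧
    (S₀ ≠ S₁ → S₀.card + 1 ≤ S₁.card + 2 * s) := by
  intro Ua₀ Ub₀ Ua₁ Ub₁ S₀ S₁ s
  classical
  -- the class-`l` cells and their boxes
  set El : Finset (Fin m × Fin m) := Finset.univ.filter fun e => ε e.1 e.2 l ≠ 0 with hEl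
  have hmemEl : ∀ e, e ∈ El ↔ ε e.1 e.2 l ≠ 0 := fun e => by simp [hEl]
  have hS₀m : IsPMatching S₀ := isPMatching_cells p₀ l
  have hS₁m : IsPMatching S₁ := isPMatching_cells p₁ l
  -- generic / odd digits on every box of `El`
  have hgenB : ∀ (G : Finset (Fin m × Fin m)), G ⊆ El → ∀ X Y : Finset (Fin m × Fin m), IsPMatching X → IsPMatching Y →
      X ⊆ G → Y ⊆ G → X.card = Y.card →
      ∑ e ∈ X, (fun e : Fin m × Fin m => u e.1 e.2 l) e = ∑ e ∈ Y, (fun e : Fin m × Fin m => u e.1 e.2 l) e → X = Y := by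
    intro G hG X Y hX hY hXG hYG hc hs
    exact hgen X Y hX hY (fun e he => (hmemEl e).1 (hG (hXG he))) (fun e he => (hmemEl e).1 (hG (hYG he))) hc hs
  -- uniqueness of the level minimiser on EVERY box, at the even slope θ₁ (weight `u − θ₁`)
  have hUq : ∀ (Ua : Finset (Fin m)) (Ub : Finset (Fin m)) (M₁ M₂ : Finset (Fin m × Fin m)),
      IsPMatching M₁ → M₁ ⊆ El.filter (fun e => e.1 ∈ Ua ∧ e.2 ∈ Ub) →
      (∀ X : Finset (Fin m × Fin m), IsPMatching X → X ⊆ El.filter (fun e => e.1 ∈ Ua ∧ e.2 ∈ Ub) →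
        ∑ e ∈ M₁, (u e.1 e.2 l - θ₁) ≤ ∑ e ∈ X, (u e.1 e.2 l - θ₁)) →
      IsPMatching M₂ → M₂ ⊆ El.filter (fun e => e.1 ∈ Ua ∧ e.2 ∈ Ub) →
      (∀ X : Finset (Fin m × Fin m), IsPMatching X → X ⊆ El.filter (fun e => e.1 ∈ Ua ∧ e.2 ∈ Ub) →
        ∑ e ∈ M₂, (u e.1 e.2 l - θ₁) ≤ ∑ e ∈ X, (u e.1 e.2 l - θ₁)) → M₁ = M₂ := by
    intro Ua Ub M₁ M₂ hM₁ hM₁G hmin₁ hM₂ hM₂G hmin₂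
    refine unique_levelMin (f := fun e : Fin m × Fin m => u e.1 e.2 l) (fun e he => ?_) he₁
      (hgenB _ (Finset.filter_subset _ _)) hM₁ hM₁G hM₂ hM₂G hmin₁ hmin₂
    exact hodd e.1 e.2 ((hmemEl e).1 (Finset.mem_filter.1 he).1)
  -- the cells minimise the level objective on their boxes (dominance, lexicographic exactness)
  have hbox : ∀ (p : Equiv.Perm (Fin m) × (Fin m → Fin K)) {θ : ℤ}, W θ → IsDominant d v ε θ p →
      ((Finset.univ.filter fun b : Fin m => p.2 b = l).image fun b => (p.1 b, b)) ⊆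
        El.filter (fun e => e.1 ∈ Finset.univ \ (Finset.univ.filter fun b => l < p.2 b).image p.1 ∧
          e.2 ∈ Finset.univ \ (Finset.univ.filter fun b => l < p.2 b)) ∧
      ∀ X : Finset (Fin m × Fin m), IsPMatching X →
        X ⊆ El.filter (fun e => e.1 ∈ Finset.univ \ (Finset.univ.filter fun b => l < p.2 b).image p.1 ∧
          e.2 ∈ Finset.univ \ (Finset.univ.filter fun b => l < p.2 b)) →
        ∑ e ∈ ((Finset.univ.filter fun b : Fin m => p.2 b = l).image fun b => (p.1 b, b)), u e.1 e.2 l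
            - θ * ((((Finset.univ.filter fun b : Fin m => p.2 b = l).image fun b => (p.1 b, b))).card : ℤ)
          ≤ ∑ e ∈ X, u e.1 e.2 l - θ * (X.card : ℤ) := by
    intro p θ hw hp
    have hpres := (termSign_ne_zero_iff ε p).1 hp.1
    constructor
    · intro e he
      rw [mem_cells] at he
      rw [Finset.mem_filter, hmemEl, Finset.mem_sdiff, Finset.mem_sdiff, Finset.mem_image, Finset.mem_filter]
      refine ⟨by rw [he.1, ← he.2]; exact hpres e.2, ⟨Finset.mem_univ _, ?_⟩, ⟨Finset.mem_univ _, ?_⟩⟩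
      · rintro ⟨b, hb, hbe⟩
        rw [Finset.mem_filter] at hb
        rw [he.1] at hbe
        have := p.1.injective hbe
        rw [this, he.2] at hb
        exact lt_irrefl _ hb.2
      · rw [he.2]; exact fun h => lt_irrefl _ h.2
    · intro X hX hXG
      refine hlev hw hp X hX
        (fun e he => (hmemEl e).1 (Finset.mem_filter.1 (hXG he)).1) (fun e he b hb => ?_) (fun e he hlt => ?_)
      · have h1 := (Finset.mem_filter.1 (hXG he)).2.1
        rw [Finset.mem_sdiff] at h1
        intro hbe
        exact h1.2 (Finset.mem_image.2 ⟨b, Finset.mem_filter.2 ⟨Finset.mem_univ _, hmono.lt_iff_lt.1 hb⟩, hbe⟩)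
      · have h1 := (Finset.mem_filter.1 (hXG he)).2.2
        rw [Finset.mem_sdiff] at h1
        exact h1.2 (Finset.mem_filter.2 ⟨Finset.mem_univ _, hmono.lt_iff_lt.1 hlt⟩)
  obtain ⟨hS₀G, hmin₀⟩ := hbox p₀ hw₀ hp₀
  obtain ⟨hS₁G, hmin₁⟩ := hbox p₁ hw₁ hp₁
  -- the intermediate optimum: minimiser at θ₁ on the box of p₀
  obtain ⟨M, hM, hMG, hminM'⟩ := exists_isMin (El.filter (fun e => e.1 ∈ Ua₀ ∧ e.2 ∈ Ub₀)) (fun e => u e.1 e.2 l - θ₁)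
  have hminM : ∀ X : Finset (Fin m × Fin m), IsPMatching X → X ⊆ El.filter (fun e => e.1 ∈ Ua₀ ∧ e.2 ∈ Ub₀) →
      ∑ e ∈ M, u e.1 e.2 l - θ₁ * (M.card : ℤ) ≤ ∑ e ∈ X, u e.1 e.2 l - θ₁ * (X.card : ℤ) := by
    intro X hX hXG; have := hminM' X hX hXG; rwa [sum_sub_const, sum_sub_const] at this
  -- θ-step on the box of p₀: count up, coverage nested
  have hcm : S₀.card ≤ M.card :=
    card_mono_of_param (u := fun e => u e.1 e.2 l) hθ hS₀m hS₀G hM hMG hmin₀ hminM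
  have hnest : dom S₀ ⊆ dom M ∧ rng S₀ ⊆ rng M :=
    cover_mono_of_param (u := fun e => u e.1 e.2 l) hθ (hgenB _ (Finset.filter_subset _ _)) hS₀m hS₀G hM hMG hmin₀ hminM
  -- flips from the box of p₀ to the box of p₁ at the fixed slope θ₁
  have hmin₁' : ∀ X : Finset (Fin m × Fin m), IsPMatching X → X ⊆ El.filter (fun e => e.1 ∈ Ua₁ ∧ e.2 ∈ Ub₁) →
      ∑ e ∈ S₁, (u e.1 e.2 l - θ₁) ≤ ∑ e ∈ X, (u e.1 e.2 l - θ₁) := by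
    intro X hX hXG; rw [sum_sub_const, sum_sub_const]; exact hmin₁ X hX hXG
  obtain ⟨f1, f2, f3⟩ := box_flips (E := El) (w := fun e => u e.1 e.2 l - θ₁) hUq s Ua₀ Ua₁ Ub₀ Ub₁ M S₁ rfl hM hMG hminM'
    hS₁m hS₁G hmin₁'
  -- coverage difference between S₀ and M: only growth
  have hd0 : (dom S₀ \ dom M).card = 0 := by rw [Finset.sdiff_eq_empty_iff_subset.2 hnest.1]; rfl
  have hr0 : (rng S₀ \ rng M).card = 0 := by rw [Finset.sdiff_eq_empty_iff_subset.2 hnest.2]; rfl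
  have hd1 : (dom M \ dom S₀).card = M.card - S₀.card := by
    rw [Finset.card_sdiff_of_subset hnest.1, hM.card_dom, hS₀m.card_dom]
  have hr1 : (rng M \ rng S₀).card = M.card - S₀.card := by
    rw [Finset.card_sdiff_of_subset hnest.2, hM.card_rng, hS₀m.card_rng]
  -- triangle inequalities through M for the coverage differences S₀ ↔ S₁
  have t1 := card_sdiff_triangle (dom S₀) (dom M) (dom S₁)
  have t2 := card_sdiff_triangle (dom S₁) (dom M) (dom S₀)
  have t3 := card_sdiff_triangle' (rng S₀) (rng M) (rng S₁)
  have t4 := card_sdiff_triangle' (rng S₁) (rng M) (rng S₀)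
  -- the free sets one level down
  have l1 := card_sdiff_sdiff_le Ua₀ Ua₁ (dom S₀) (dom S₁)
  have l2 := card_sdiff_sdiff_le Ua₁ Ua₀ (dom S₁) (dom S₀)
  have l3 := card_sdiff_sdiff_le Ub₀ Ub₁ (rng S₀) (rng S₁)
  have l4 := card_sdiff_sdiff_le Ub₁ Ub₀ (rng S₁) (rng S₀)
  refine ⟨by omega, by omega, fun hne => ?_⟩
  -- the change indicator
  by_cases hs : s = 0
  · -- no flips: the boxes coincide, so `S₁ = M`, and a change forces a larger count
    have e1 : Ua₀ \ Ua₁ = ∅ := Finset.card_eq_zero.1 (by omega)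
    have e2 : Ua₁ \ Ua₀ = ∅ := Finset.card_eq_zero.1 (by omega)
    have e3 : Ub₀ \ Ub₁ = ∅ := Finset.card_eq_zero.1 (by omega)
    have e4 : Ub₁ \ Ub₀ = ∅ := Finset.card_eq_zero.1 (by omega)
    rw [Finset.sdiff_eq_empty_iff_subset] at e1 e2 e3 e4
    have hUa : Ua₁ = Ua₀ := Finset.Subset.antisymm e2 e1
    have hUb : Ub₁ = Ub₀ := Finset.Subset.antisymm e4 e3
    have hS₁G' : S₁ ⊆ El.filter (fun e => e.1 ∈ Ua₀ ∧ e.2 ∈ Ub₀) := by rw [← hUa, ← hUb]; exact hS₁G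
    have hmin₁G : ∀ X : Finset (Fin m × Fin m), IsPMatching X → X ⊆ El.filter (fun e => e.1 ∈ Ua₀ ∧ e.2 ∈ Ub₀) →
        ∑ e ∈ S₁, (u e.1 e.2 l - θ₁) ≤ ∑ e ∈ X, (u e.1 e.2 l - θ₁) := by rw [← hUa, ← hUb]; exact hmin₁'
    have hmin₁P : ∀ X : Finset (Fin m × Fin m), IsPMatching X → X ⊆ El.filter (fun e => e.1 ∈ Ua₀ ∧ e.2 ∈ Ub₀) →
        ∑ e ∈ S₁, u e.1 e.2 l - θ₁ * (S₁.card : ℤ) ≤ ∑ e ∈ X, u e.1 e.2 l - θ₁ * (X.card : ℤ) := by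
      intro X hX hXG; have := hmin₁G X hX hXG; rwa [sum_sub_const, sum_sub_const] at this
    -- if the counts were equal, S₀ = S₁
    by_contra hlt
    have hc : S₀.card = S₁.card := by omega
    have huniq₁ : ∀ X : Finset (Fin m × Fin m), IsPMatching X → X ⊆ El.filter (fun e => e.1 ∈ Ua₀ ∧ e.2 ∈ Ub₀) →
        ∑ e ∈ X, u e.1 e.2 l - θ₁ * (X.card : ℤ) ≤ ∑ e ∈ S₁, u e.1 e.2 l - θ₁ * (S₁.card : ℤ) → X = S₁ := by
      intro X hX hXG hle
      refine hUq Ua₀ Ub₀ X S₁ hX hXG (fun Y hY hYG => ?_) hS₁m hS₁G' hmin₁G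
      rw [sum_sub_const, sum_sub_const]; exact hle.trans (hmin₁P Y hY hYG)
    exact hne (eq_of_param_of_card_eq (u := fun e => u e.1 e.2 l) hS₀m hS₀G hS₁m hS₁G' hmin₀ huniq₁ hc)
  · omega

/-- **THE TOWER THEOREM FROM A BRIDGE: `n ≤ K·m·5^K`.**  As `chain_le_tower` (…SeparatedTower), with the design hypotheses replaced by
the level-minimality bridge `hlev` (for every class `l ≠ z`, at every slope of the window predicate `W`): classes in increasing exponent
order with `d z = 0`, odd and generic digits in every class `j ≠ z`, a chain of pairwise distinct terms dominant at strictly increasing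
EVEN slopes of the window. -/
theorem chain_le_tower_of_levelMin (d : Fin K → ℕ) (v ε : Fin m → Fin m → Fin K → ℤ) (u : Fin m → Fin m → Fin K → ℤ)
    (z : Fin K) (hdz : d z = 0) (hmono : StrictMono d) (W : ℤ → Prop)
    (hlev : ∀ l, l ≠ z → ∀ {θ : ℤ}, W θ → ∀ {p : Equiv.Perm (Fin m) × (Fin m → Fin K)}, IsDominant d v ε θ p →
      ∀ X : Finset (Fin m × Fin m), IsPMatching X → (∀ e ∈ X, ε e.1 e.2 l ≠ 0) →
        (∀ e ∈ X, ∀ b, d l < d (p.2 b) → p.1 b ≠ e.1) → (∀ e ∈ X, ¬ d l < d (p.2 e.2)) →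
        ∑ e ∈ ((Finset.univ.filter fun b : Fin m => p.2 b = l).image fun b => (p.1 b, b)), u e.1 e.2 l
            - θ * ((((Finset.univ.filter fun b : Fin m => p.2 b = l).image fun b => (p.1 b, b))).card : ℤ)
          ≤ ∑ e ∈ X, u e.1 e.2 l - θ * (X.card : ℤ))
    (hodd : ∀ a b j, j ≠ z → ε a b j ≠ 0 → Odd (u a b j))
    (hgen : ∀ j, j ≠ z → ∀ X Y : Finset (Fin m × Fin m), IsPMatching X → IsPMatching Y → (∀ e ∈ X, ε e.1 e.2 j ≠ 0) →
      (∀ e ∈ Y, ε e.1 e.2 j ≠ 0) → X.card = Y.card → ∑ e ∈ X, u e.1 e.2 j = ∑ e ∈ Y, u e.1 e.2 j → X = Y)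
    {n : ℕ} (θ : Fin (n + 1) → ℤ) (p : Fin (n + 1) → Equiv.Perm (Fin m) × (Fin m → Fin K))
    (hθ : StrictMono θ) (heven : ∀ k, Even (θ k)) (hwin : ∀ k, W (θ k))
    (hdom : ∀ k, IsDominant d v ε (θ k) (p k)) (hne : ∀ k : Fin n, p k.castSucc ≠ p k.succ) :
    n ≤ K * m * 5 ^ K := by
  classical
  -- `z` is the least class
  have hz0 : (z : ℕ) = 0 := by
    by_contra h
    have : d ⟨0, by omega⟩ < d z := hmono (Fin.lt_def.2 (by simp; omega))
    rw [hdz] at this; exact Nat.not_lt_zero _ this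
  have hKpos : 0 < K := Fin.pos z
  -- the objects of the tower
  let Ua : Fin K → Fin (n + 1) → Finset (Fin m) := fun l k => Finset.univ \ (Finset.univ.filter fun b => l < (p k).2 b).image (p k).1
  let Ub : Fin K → Fin (n + 1) → Finset (Fin m) := fun l k => Finset.univ \ (Finset.univ.filter fun b => l < (p k).2 b)
  let S : Fin K → Fin (n + 1) → Finset (Fin m × Fin m) := fun l k =>
    (Finset.univ.filter fun b : Fin m => (p k).2 b = l).image fun b => ((p k).1 b, b)
  let sd : Fin K → Fin n → ℕ := fun l k => (Ua l k.castSucc \ Ua l k.succ).card + (Ua l k.succ \ Ua l k.castSucc).card +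
    (Ub l k.castSucc \ Ub l k.succ).card + (Ub l k.succ \ Ub l k.castSucc).card
  -- THE STEP at every level l ≠ z
  have hstep : ∀ (l : Fin K), l ≠ z → ∀ k : Fin n,
      (S l k.castSucc).card ≤ (S l k.succ).card + (Ua l k.castSucc \ Ua l k.succ).card + (Ub l k.castSucc \ Ub l k.succ).card ∧
      ((Ua l k.castSucc \ dom (S l k.castSucc)) \ (Ua l k.succ \ dom (S l k.succ))).card +
        ((Ua l k.succ \ dom (S l k.succ)) \ (Ua l k.castSucc \ dom (S l k.castSucc))).card +
        ((Ub l k.castSucc \ rng (S l k.castSucc)) \ (Ub l k.succ \ rng (S l k.succ))).card +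
        ((Ub l k.succ \ rng (S l k.succ)) \ (Ub l k.castSucc \ rng (S l k.castSucc))).card + 2 * (S l k.castSucc).card ≤
        5 * sd l k + 2 * (S l k.succ).card ∧
      (S l k.castSucc ≠ S l k.succ → (S l k.castSucc).card + 1 ≤ (S l k.succ).card + 2 * sd l k) :=
    fun l hl k => level_step_of_levelMin d v ε u l hmono W (hlev l hl) (fun a b he => hodd a b l hl he) (hgen l hl)
      (hθ Fin.castSucc_lt_succ) (heven k.succ) (hwin k.castSucc) (hwin k.succ) (hdom k.castSucc) (hdom k.succ)
  -- every step changes some level l ≠ z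
  have hchg : ∀ k : Fin n, ∃ l : Fin K, l ≠ z ∧ S l k.castSucc ≠ S l k.succ := by
    intro k
    by_contra hall
    have hall' : ∀ l : Fin K, l ≠ z → S l k.castSucc = S l k.succ := fun l hl => by
      by_contra h; exact hall ⟨l, hl, h⟩
    refine not_dominant_of_cls_eq d v ε (hdom k.castSucc) (hdom k.succ) (hne k) ?_
    funext b
    have key : ∀ (q q' : Equiv.Perm (Fin m) × (Fin m → Fin K)) (j : Fin K), j ≠ z →
        ((Finset.univ.filter fun b : Fin m => q.2 b = j).image fun b => (q.1 b, b)) =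
          ((Finset.univ.filter fun b : Fin m => q'.2 b = j).image fun b => (q'.1 b, b)) → q.2 b = j → q'.2 b = j := by
      intro q q' j _ hS hb
      have : b ∈ rng ((Finset.univ.filter fun b : Fin m => q.2 b = j).image fun b => (q.1 b, b)) := by
        rw [rng_cells, Finset.mem_filter]; exact ⟨Finset.mem_univ _, hb⟩
      rw [hS, rng_cells, Finset.mem_filter] at this
      exact this.2
    by_cases h0 : (p k.castSucc).2 b = z
    · by_cases h1 : (p k.succ).2 b = z
      · rw [h0, h1]
      · have := key (p k.succ) (p k.castSucc) _ h1 (hall' _ h1).symm rfl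
        exact absurd (this.symm.trans h0) h1
    · exact (key (p k.castSucc) (p k.succ) _ h0 (hall' _ h0) rfl).symm
  -- prefix sums over ℕ indices
  let cN : Fin K → ℕ → ℕ := fun l i => if h : i < n + 1 then (S l ⟨i, h⟩).card else 0
  let sN : Fin K → ℕ → ℕ := fun l i => if h : i < n then sd l ⟨i, h⟩ else 0
  let T : Fin K → ℕ → ℕ := fun l i => ∑ j ∈ Finset.range i, sN l j
  have hT_succ : ∀ l i, T l (i + 1) = T l i + sN l i := fun l i => Finset.sum_range_succ _ _
  have hcN_le : ∀ l i, cN l i ≤ m := by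
    intro l i; simp only [cN]; split_ifs with h
    · exact card_le_of_isPMatching (isPMatching_cells _ _)
    · exact Nat.zero_le _
  -- the potential Σ_{l ≠ z} (c_l + 2 T_l) increases at every step
  let L : Finset (Fin K) := Finset.univ.erase z
  have hpot : ∀ i : ℕ, i ≤ n → (∑ l ∈ L, cN l 0) + i ≤ ∑ l ∈ L, (cN l i + 2 * T l i) := by
    intro i
    induction i with
    | zero => intro _; simp [T]
    | succ i ih =>
      intro hi
      have h1 := ih (by omega)
      set k : Fin n := ⟨i, by omega⟩ with hk
      have ek0 : k.castSucc = ⟨i, by omega⟩ := rfl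
      have ek1 : k.succ = ⟨i + 1, by omega⟩ := rfl
      -- per level: no decrease; at the changed level: increase
      have hmono_l : ∀ l ∈ L, cN l i + 2 * T l i ≤ cN l (i + 1) + 2 * T l (i + 1) := by
        intro l hl
        have hlz : l ≠ z := Finset.ne_of_mem_erase hl
        obtain ⟨a1, -, -⟩ := hstep l hlz k
        rw [ek0, ek1] at a1
        have e0 : cN l i = (S l ⟨i, by omega⟩).card := by simp only [cN, dif_pos (show i < n + 1 by omega)]
        have e1 : cN l (i + 1) = (S l ⟨i + 1, by omega⟩).card := by simp only [cN, dif_pos (show i + 1 < n + 1 by omega)]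
        have e2 : sN l i = sd l k := by simp only [sN, dif_pos (show i < n by omega), hk]
        rw [hT_succ, e0, e1, e2]
        have : (Ua l k.castSucc \ Ua l k.succ).card + (Ub l k.castSucc \ Ub l k.succ).card ≤ sd l k := by
          simp only [sd]; omega
        rw [ek0, ek1] at this
        omega
      obtain ⟨l₀, hl₀z, hl₀⟩ := hchg k
      have hl₀L : l₀ ∈ L := Finset.mem_erase.2 ⟨hl₀z, Finset.mem_univ _⟩
      have hstrict : cN l₀ i + 2 * T l₀ i + 1 ≤ cN l₀ (i + 1) + 2 * T l₀ (i + 1) := by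
        obtain ⟨-, -, a3⟩ := hstep l₀ hl₀z k
        have a3' := a3 hl₀
        rw [ek0, ek1] at a3'
        have e0 : cN l₀ i = (S l₀ ⟨i, by omega⟩).card := by simp only [cN, dif_pos (show i < n + 1 by omega)]
        have e1 : cN l₀ (i + 1) = (S l₀ ⟨i + 1, by omega⟩).card := by simp only [cN, dif_pos (show i + 1 < n + 1 by omega)]
        have e2 : sN l₀ i = sd l₀ k := by simp only [sN, dif_pos (show i < n by omega), hk]
        rw [hT_succ, e0, e1, e2]
        omega
      have s1 := Finset.sum_erase_add L (fun l => cN l i + 2 * T l i) hl₀L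
      have s2 := Finset.sum_erase_add L (fun l => cN l (i + 1) + 2 * T l (i + 1)) hl₀L
      have hrest : ∑ l ∈ L.erase l₀, (cN l i + 2 * T l i) ≤ ∑ l ∈ L.erase l₀, (cN l (i + 1) + 2 * T l (i + 1)) :=
        Finset.sum_le_sum fun l hl => hmono_l l (Finset.mem_of_mem_erase hl)
      omega
  -- the T recursion down the levels: T_l ≤ 5 T_{l+1} + 2m
  have hTrec : ∀ (l l' : Fin K), (l' : ℕ) = l + 1 → T l n ≤ 5 * T l' n + 2 * m := by
    intro l l' hl
    have hl'z : l' ≠ z := fun h => by rw [h, hz0] at hl; omega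
    have inv : ∀ i : ℕ, i ≤ n → T l i + 2 * cN l' 0 ≤ 5 * T l' i + 2 * cN l' i := by
      intro i
      induction i with
      | zero => intro _; simp [T]
      | succ i ih =>
        intro hi
        have h1 := ih (by omega)
        set k : Fin n := ⟨i, by omega⟩ with hk
        obtain ⟨-, a2, -⟩ := hstep l' hl'z k
        -- the free sets of level l' are the box of level l
        have r0 : Ua l k.castSucc = Ua l' k.castSucc \ dom (S l' k.castSucc) := rows_succ (p k.castSucc) l l' hl
        have r1 : Ua l k.succ = Ua l' k.succ \ dom (S l' k.succ) := rows_succ (p k.succ) l l' hl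
        have c0 : Ub l k.castSucc = Ub l' k.castSucc \ rng (S l' k.castSucc) := cols_succ (p k.castSucc) l l' hl
        have c1 : Ub l k.succ = Ub l' k.succ \ rng (S l' k.succ) := cols_succ (p k.succ) l l' hl
        have hsd : sd l k = ((Ua l' k.castSucc \ dom (S l' k.castSucc)) \ (Ua l' k.succ \ dom (S l' k.succ))).card +
            ((Ua l' k.succ \ dom (S l' k.succ)) \ (Ua l' k.castSucc \ dom (S l' k.castSucc))).card +
            ((Ub l' k.castSucc \ rng (S l' k.castSucc)) \ (Ub l' k.succ \ rng (S l' k.succ))).card +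
            ((Ub l' k.succ \ rng (S l' k.succ)) \ (Ub l' k.castSucc \ rng (S l' k.castSucc))).card := by
          simp only [sd]; rw [r0, r1, c0, c1]
        have e0 : cN l' i = (S l' k.castSucc).card := by simp only [cN, dif_pos (show i < n + 1 by omega)]; rfl
        have e1 : cN l' (i + 1) = (S l' k.succ).card := by simp only [cN, dif_pos (show i + 1 < n + 1 by omega)]; rfl
        have e2 : sN l i = sd l k := by simp only [sN, dif_pos (show i < n by omega), hk]
        have e3 : sN l' i = sd l' k := by simp only [sN, dif_pos (show i < n by omega), hk]
        rw [hT_succ, hT_succ, e1, e2, e3, hsd]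
        rw [e0] at h1
        omega
    have := inv n le_rfl
    have := hcN_le l' n
    omega
  -- the top level never flips
  have hTtop : T ⟨K - 1, by omega⟩ n = 0 := by
    apply Finset.sum_eq_zero
    intro j hj
    simp only [sN]
    split_ifs with h
    · have hempty : ∀ k : Fin (n + 1), (Finset.univ.filter fun b : Fin m => (⟨K - 1, by omega⟩ : Fin K) < (p k).2 b) = ∅ := by
        intro k; rw [Finset.filter_eq_empty_iff]; intro b _ hb
        rw [Fin.lt_def] at hb; have := ((p k).2 b).2; simp at hb; omega
      simp [sd, Ua, Ub, hempty]
    · rfl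
  -- geometric bound: 2 T_l + m ≤ m · 5^(K-1-l)
  have hgeo : ∀ j : ℕ, (hj : j ≤ K - 1) → 2 * T ⟨K - 1 - j, by omega⟩ n + m ≤ m * 5 ^ j := by
    intro j
    induction j with
    | zero =>
      intro _
      have e : (⟨K - 1 - 0, by omega⟩ : Fin K) = ⟨K - 1, by omega⟩ := Fin.ext (by simp)
      rw [e, hTtop]; simp
    | succ j ih =>
      intro hj
      have h1 := ih (by omega)
      have h2 := hTrec ⟨K - 1 - (j + 1), by omega⟩ ⟨K - 1 - j, by omega⟩ (by simp; omega)
      rw [pow_succ]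
      nlinarith
  -- assemble
  have hfin := hpot n le_rfl
  have hbound : ∀ l ∈ L, cN l n + 2 * T l n ≤ m * 5 ^ K := by
    intro l hl
    have hlK : (l : ℕ) ≤ K - 1 := by have := l.2; omega
    have h1 := hgeo (K - 1 - l) (by omega)
    have e : (⟨K - 1 - (K - 1 - (l : ℕ)), by omega⟩ : Fin K) = l := Fin.ext (by simp; omega)
    rw [e] at h1
    have h2 := hcN_le l n
    have h3 : m * 5 ^ (K - 1 - (l : ℕ)) ≤ m * 5 ^ K := Nat.mul_le_mul_left _ (Nat.pow_le_pow_right (by norm_num) (by omega))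
    omega
  have hsum : ∑ l ∈ L, (cN l n + 2 * T l n) ≤ ∑ l ∈ L, m * 5 ^ K := Finset.sum_le_sum hbound
  rw [Finset.sum_const, smul_eq_mul] at hsum
  have hL : L.card ≤ K := (Finset.card_le_univ _).trans (by simp)
  have : L.card * (m * 5 ^ K) ≤ K * (m * 5 ^ K) := Nat.mul_le_mul_right _ hL
  have h0 : 0 ≤ ∑ l ∈ L, cN l 0 := Nat.zero_le _
  calc n ≤ ∑ l ∈ L, (cN l n + 2 * T l n) := by omega
    _ ≤ K * m * 5 ^ K := by rw [Nat.mul_assoc]; omega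

end SeparatedLex

end Summit.ValiantsHypothesis.ValiantsHypothesis.Theorems.KPlusLogSqLaw
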